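import Literature.MathematicalPhysics.QuantumLattice.PeierlsChessboardContourBound
import Literature.MathematicalPhysics.QuantumLattice.PeierlsContourAssignmentBound
import HarnessLib

/-!
# Fröhlich–Lieb (1.30) + (1.42)–(1.44) in the CONTOUR-ASSIGNMENT form:
# `⟨Pₘ⁺Pₙ⁻⟩ ≤ Σ_{γ ∈ 𝒢} κ^{c(b,d)|γ|}` for any compatible assignment `c ↦ γ(c) ∈ 𝒢`

Topic `MathematicalPhysics/QuantumLattice`. `PeierlsChessboardContourBound` bounds `⟨Pₘ⁺Pₙ⁻⟩` by the
sum over the `+` clusters `C ∋ m` of `κ^{c|∂C|}` (FULL boundary of the cluster); that series is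
finite on each torus but not uniformly in the volume (clusters with holes). Fröhlich–Lieb instead
assign to every configuration ONE contour `γ(c)` (in `d = 2`: a connected separating component)
and resum the rest (their (1.29)) — the analytic half of that is
`PeierlsContourAssignmentBound.peierls_bound_of_assignment_gibbs`:
`Re⟨Pₘ⁺Pₙ⁻⟩ ≤ Σ_{γ ∈ 𝒢} Re⟨∏_{⟨i,j⟩ ∈ γ} Pᵢ⁺Pⱼ⁻⟩` for ANY compatible assignment into a finite
family `𝒢`. This file supplies the chessboard half for such bond families:

* `selectedOp_posSemidef`, `selectedOp_sub_selectedOp_posSemidef` — FL (1.28) for sub-selections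
  of a bond family (`S₊' ⊆ S₊`, `S₋' ⊆ S₋`, `S₊ ∩ S₋ = ∅`);
* **`re_gibbsState_selectedOp_le_pow`** — for `H` Hermitian, translation invariant, `-βH`
  reflection positive across the planes between the cubes of side `b` of `(ℤ/Nbℤ)^d` (`N` even,
  `N > 1`), real `0 ≤ P± ≤ 1`, `0 ≤ κ ≤ 1` with `Re⟨P_Λ(p)⟩ ≤ κ^{N^d}` for every DIPOLE cube
  pattern, and ANY finite family `γ` of nearest-neighbour bonds `(i, j)` whose `+` ends and `-`
  ends are disjoint: `Re⟨∏_{(i,j) ∈ γ} Pᵢ⁺Pⱼ⁻⟩ ≤ κ^{(b-1)|γ|/b^{2d+1}}` (select one interior bond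
  per cube of a good shifted partition `exists_shift_cube_selection`, drop the other factors,
  translate, block chessboard, `N^d`-th root);
* **`peierls_chessboard_bound_of_assignment`** — FL (1.30) + (1.44) for an arbitrary compatible
  assignment `c ↦ γ(c) ∈ 𝒢` of bond families:
  `Re⟨Pₘ⁺Pₙ⁻⟩_{β,H} ≤ Σ_{γ ∈ 𝒢} κ^{(b-1)|γ|/b^{2d+1}}`;
* `exists_card_cubes_re_gibbsState_selectedOp_le`, **`re_gibbsState_selectedOp_le_theta_pow`**,
  **`peierls_chessboard_bound_of_assignment_theta`** — the same with EXACT exponents: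
  `Re⟨∏_γ Pᵢ⁺Pⱼ⁻⟩ ≤ θ^{|γ|}`, `θ = κ^{(b-1)/b^{2d+1}}` (`0 < κ ≤ 1`; no integer rounding, so every
  contour length carries a weight `< 1`), and `Re⟨Pₘ⁺Pₙ⁻⟩ ≤ Σ_{γ ∈ 𝒢} θ^{|bonds γ|}`;
* `heisAnisoReal_peierls_chessboard_bound_of_assignment` — the three hypotheses on `H` discharged
  for the rotated antiferromagnet with direction-dependent couplings `K ≥ 0` (every spin, every
  `β ≥ 0`).

The topological input of FL Thm. 1.1 (which `𝒢` and `γ(·)` to take on the 2-torus, and how many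
`γ ∈ 𝒢` have `|γ| = ℓ`) is separate and not used here. No named facts; no sorries.

## References

* J. Fröhlich, E. H. Lieb, *Phase transitions in anisotropic lattice spin systems*, Comm. Math.
  Phys. **60** (1978) 233–267, §I.C (1.26)–(1.31), §I.D (1.41)–(1.45). [FrohlichLieb1978]
* J. Fröhlich, R. Israel, E. H. Lieb, B. Simon, Comm. Math. Phys. **62** (1978) 1–34, Thm. 4.3.
  [FrohlichIsraelLiebSimon1978]
-/

noncomputable section

open Matrix Finset NormedSpace
open scoped Kronecker ComplexOrder MatrixOrder BigOperators
open Literature.MathematicalPhysics.QuantumLattice Literature.Probability.LatticeModels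
  Literature.Barriers.CriticalPhenomena.NonGibbs

namespace Literature.MathematicalPhysics.QuantumLattice

/-! ### Sub-selections of a bond family: FL (1.28) -/

section Selected

variable {d : ℕ} {N b : ℕ} {n : ℕ}

/-- The sub-selected pattern `P⁺` on `S₊`, `P⁻` on `S₋`, `1` elsewhere is positive semidefinite
sitewise when `P± ≥ 0`. [cite: FrohlichLieb1978, eq. (1.28)] -/
theorem selectedOp_posSemidef [NeZero (N * b)] {Pp Pm : Matrix (Fin (n + 1)) (Fin (n + 1)) ℂ}
    (hPp : Pp.PosSemidef) (hPm : Pm.PosSemidef) (Sp Sm : Finset (TorusSite d (N * b)))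
    (x : TorusSite d (N * b)) : (selectedOp Pp Pm Sp Sm x).PosSemidef := by
  unfold selectedOp
  split_ifs
  exacts [hPp, hPm, PosSemidef.one]

/-- **FL (1.28) for bond families**: shrinking the selected sets (`S₊' ⊆ S₊`, `S₋' ⊆ S₋`, with
`S₊ ∩ S₋ = ∅`) increases the pattern sitewise in the Loewner order when `0 ≤ P± ≤ 1`:
`∏_{S₊}P⁺∏_{S₋}P⁻ ≤ ∏_{S₊'}P⁺∏_{S₋'}P⁻` factor by factor. [cite: FrohlichLieb1978, eq. (1.28)] -/
theorem selectedOp_sub_selectedOp_posSemidef [NeZero (N * b)]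
    {Pp Pm : Matrix (Fin (n + 1)) (Fin (n + 1)) ℂ} (hPp1 : (1 - Pp).PosSemidef)
    (hPm1 : (1 - Pm).PosSemidef) {Sp Sm Sp' Sm' : Finset (TorusSite d (N * b))}
    (hdisj : Disjoint Sp Sm) (hSp : Sp' ⊆ Sp) (hSm : Sm' ⊆ Sm) (x : TorusSite d (N * b)) :
    (selectedOp Pp Pm Sp' Sm' x - selectedOp Pp Pm Sp Sm x).PosSemidef := by
  unfold selectedOp
  by_cases h1 : x ∈ Sp'
  · rw [if_pos h1, if_pos (hSp h1), sub_self]; exact PosSemidef.zero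
  rw [if_neg h1]
  by_cases h2 : x ∈ Sm'
  · have hx : x ∉ Sp := fun h => disjoint_left.1 hdisj h (hSm h2)
    rw [if_pos h2, if_neg hx, if_pos (hSm h2), sub_self]; exact PosSemidef.zero
  rw [if_neg h2]
  split_ifs
  · exact hPp1
  · exact hPm1
  · rw [sub_self]; exact PosSemidef.zero

end Selected

/-! ### The chessboard bound for one bond family -/

section BondFamily

variable {d : ℕ} {N b : ℕ} [NeZero N] [NeZero b] {n : ℕ}

/-- **Chessboard bound for the observable of a bond family (FL (1.42)–(1.44)).** Let `H` be
Hermitian and translation invariant on the torus `(ℤ/Nbℤ)^d` (`N` even, `N > 1`) with `-βH`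
reflection positive across the planes between the cubes of side `b`; `0 ≤ P± ≤ 1` real single-site
matrices; `0 ≤ κ ≤ 1` with `Re⟨P_Λ(p)⟩ ≤ κ^{N^d}` for the universal projection of every DIPOLE
cube pattern `p` (`P⁺` at `i`, `P⁻` at a nearest neighbour `j` in the same cube of a shifted
partition). Then for every finite family `γ` of nearest-neighbour bonds `(i, j)` whose set of first
ends is disjoint from its set of second ends,
`Re⟨∏_{i ∈ fst γ} Pᵢ⁺ ∏_{j ∈ snd γ} Pⱼ⁻⟩_{β,H} ≤ κ^{(b-1)|γ|/b^{2d+1}}`.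
[cite: FrohlichLieb1978, eqs. (1.41)–(1.45)] [cite: FrohlichIsraelLiebSimon1978, Thm. 4.3] -/
theorem re_gibbsState_selectedOp_le_pow [NeZero (N * b)] (hd : 0 < d) (hN : Even N)
    (hN1 : 1 < N) {β : ℝ} {H : Op (TorusSite d (N * b)) (n + 1)} (hH : H.IsHermitian)
    (hK : ∀ (i : Fin d) (k : ZMod N),
      IsRPExponent (N * b) i (blockPlane N b k) (hN.mul_right b) (-(β : ℂ) • H))
    (hT : ∀ v : TorusSite d (N * b),
      H.submatrix (fun σ => σ ∘ ⇑(Equiv.addRight v)) (fun σ => σ ∘ ⇑(Equiv.addRight v)) = H)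
    {Pp Pm : Matrix (Fin (n + 1)) (Fin (n + 1)) ℂ} (hPp : Pp.PosSemidef) (hPm : Pm.PosSemidef)
    (hPp1 : (1 - Pp).PosSemidef) (hPm1 : (1 - Pm).PosSemidef)
    (hPpr : Pp.map (starRingEnd ℂ) = Pp) (hPmr : Pm.map (starRingEnd ℂ) = Pm)
    {κ : ℝ} (hκ0 : 0 ≤ κ) (hκ1 : κ ≤ 1)
    (hsmall : ∀ (v i j : TorusSite d (N * b)),
      (∃ k : Fin d, j = i + Pi.single k 1 ∨ i = j + Pi.single k 1) →
      blockOf N b (i - v) = blockOf N b (j - v) →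
      (Matrix.gibbsState β H (productOp fun y =>
        cubePattern hN v (selectedOp Pp Pm {i} {j}) (blockOf N b (i - v))
          (mirroredOffset hN y))).re ≤ κ ^ (N ^ d))
    (γ : Finset (TorusSite d (N * b) × TorusSite d (N * b)))
    (hadj : ∀ e ∈ γ, ∃ k : Fin d, e.2 = e.1 + Pi.single k 1 ∨ e.1 = e.2 + Pi.single k 1)
    (hdisj : Disjoint (γ.image Prod.fst) (γ.image Prod.snd)) :
    (Matrix.gibbsState β H (productOp (selectedOp Pp Pm (γ.image Prod.fst) (γ.image Prod.snd)))).re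
      ≤ κ ^ ((b - 1) * γ.card / b ^ (2 * d + 1)) := by
  classical
  haveI : Nonempty (TensorIndex (TorusSite d (N * b)) (n + 1)) := ⟨fun _ => 0⟩
  -- one interior bond per cube of a good shifted partition
  obtain ⟨v, D, sel, hsel, hcount⟩ := exists_shift_cube_selection γ hadj
  set Sp' := D.image fun c => (sel c).1 with hSp'
  set Sm' := D.image fun c => (sel c).2 with hSm'
  have hSp : Sp' ⊆ γ.image Prod.fst := by
    intro x hx
    obtain ⟨c, hc, rfl⟩ := mem_image.1 hx
    exact mem_image.2 ⟨sel c, (hsel c hc).1, rfl⟩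
  have hSm : Sm' ⊆ γ.image Prod.snd := by
    intro x hx
    obtain ⟨c, hc, rfl⟩ := mem_image.1 hx
    exact mem_image.2 ⟨sel c, (hsel c hc).1, rfl⟩
  -- Step 1: drop the unselected factors
  have hpos : ∀ X : Op (TorusSite d (N * b)) (n + 1), X.PosSemidef →
      0 ≤ (Matrix.gibbsState β H X).re :=
    fun X hX => (Complex.nonneg_iff.1 (Matrix.gibbsState_nonneg_of_posSemidef β hH hX)).1
  have hdrop : (Matrix.gibbsState β H
      (productOp (selectedOp Pp Pm (γ.image Prod.fst) (γ.image Prod.snd)))).re ≤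
      (Matrix.gibbsState β H (productOp (selectedOp Pp Pm Sp' Sm'))).re :=
    re_le_re_of_productOp_le (fun x => selectedOp_posSemidef hPp hPm _ _ x)
      (fun x => selectedOp_sub_selectedOp_posSemidef hPp1 hPm1 hdisj hSp hSm x) _ hpos
  -- Step 2: the selected observable lives on the cubes `v + c`, `c ∈ D`
  have hreal : ∀ x, (selectedOp Pp Pm Sp' Sm' x).map (starRingEnd ℂ) = selectedOp Pp Pm Sp' Sm' x := by
    intro x
    unfold selectedOp
    split_ifs
    exacts [hPpr, hPmr, Matrix.map_one _ (map_zero _) (map_one _)]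
  have hsupp : ∀ x, blockOf N b (x - v) ∉ D → selectedOp Pp Pm Sp' Sm' x = 1 := by
    intro x hx
    have h1 : x ∉ Sp' := by
      intro h
      obtain ⟨c, hc, rfl⟩ := mem_image.1 h
      exact hx (by rw [(hsel c hc).2.1]; exact hc)
    have h2 : x ∉ Sm' := by
      intro h
      obtain ⟨c, hc, rfl⟩ := mem_image.1 h
      exact hx (by rw [(hsel c hc).2.2]; exact hc)
    unfold selectedOp
    rw [if_neg h1, if_neg h2]
  have hpow := re_gibbsState_productOp_pow_le_of_supported hd hN hN1 hH hK hT
    (selectedOp Pp Pm Sp' Sm') hreal v D hsupp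
  -- Step 3: every selected cube carries a dipole pattern
  have hfac : ∀ c ∈ D, (Matrix.gibbsState β H (productOp fun y =>
      cubePattern hN v (selectedOp Pp Pm Sp' Sm') c (mirroredOffset hN y))).re ≤ κ ^ (N ^ d) := by
    intro c hc
    have hpat := cubePattern_selectedOp_image_eq hN Pp Pm v D sel (fun c' hc' => (hsel c' hc').2) hc
    have hint : blockOf N b ((sel c).1 - v) = blockOf N b ((sel c).2 - v) := by
      rw [(hsel c hc).2.1, (hsel c hc).2.2]
    have hs := hsmall v (sel c).1 (sel c).2 (hadj _ (hsel c hc).1) hint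
    rw [(hsel c hc).2.1] at hs
    rw [hSp', hSm', hpat]
    exact hs
  have h0 : ∀ c ∈ D, 0 ≤ (Matrix.gibbsState β H (productOp fun y =>
      cubePattern hN v (selectedOp Pp Pm Sp' Sm') c (mirroredOffset hN y))).re :=
    fun c _ => re_gibbsState_blockPattern_universal_nonneg hd hN hN1 hH hK _ fun o => hreal _
  -- Step 4: take the `N^d`-th root and compare exponents
  set r := (Matrix.gibbsState β H (productOp (selectedOp Pp Pm Sp' Sm'))).re with hr
  have hn : (N ^ d : ℕ) ≠ 0 := pow_ne_zero _ (NeZero.ne N)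
  have hle : |r| ^ (N ^ d) ≤ (κ ^ D.card) ^ (N ^ d) :=
    calc |r| ^ (N ^ d) ≤ ∏ c ∈ D, (Matrix.gibbsState β H (productOp fun y =>
          cubePattern hN v (selectedOp Pp Pm Sp' Sm') c (mirroredOffset hN y))).re := hpow
      _ ≤ ∏ c ∈ D, κ ^ (N ^ d) := prod_le_prod h0 hfac
      _ = (κ ^ D.card) ^ (N ^ d) := by rw [prod_const, ← pow_mul, mul_comm, pow_mul]
  have habs : |r| ≤ κ ^ D.card := le_of_pow_le_pow_left₀ hn (pow_nonneg hκ0 _) hle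
  calc (Matrix.gibbsState β H
        (productOp (selectedOp Pp Pm (γ.image Prod.fst) (γ.image Prod.snd)))).re
      ≤ r := hdrop
    _ ≤ |r| := le_abs_self r
    _ ≤ κ ^ D.card := habs
    _ ≤ κ ^ ((b - 1) * γ.card / b ^ (2 * d + 1)) :=
        pow_le_pow_of_le_one hκ0 hκ1 (Nat.div_le_of_le_mul hcount)

end BondFamily

/-! ### FL (1.30) + (1.44) for an arbitrary compatible assignment -/

section Assignment

variable {d : ℕ} {N b : ℕ} [NeZero N] [NeZero b] {n : ℕ}

omit [NeZero N] [NeZero b] in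
/-- The product observable of `peierls_bound_of_assignment` is the selected pattern.
[cite: FrohlichLieb1978, eqs. (1.29)–(1.30)] -/
theorem productOp_ite_eq_selectedOp [NeZero (N * b)] (Pp Pm : Matrix (Fin (n + 1)) (Fin (n + 1)) ℂ)
    (Sp Sm : Finset (TorusSite d (N * b))) :
    (productOp fun j => if j ∈ Sp then Pp else if j ∈ Sm then Pm else 1) =
      productOp (selectedOp Pp Pm Sp Sm) := rfl

/-- **Fröhlich–Lieb (1.30) + (1.44) in the contour-assignment form.** Let `H` be Hermitian and
translation invariant on the torus `(ℤ/Nbℤ)^d` (`N` even, `N > 1`) with `-βH` reflection positive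
across the planes between the cubes of side `b`; real single-site `0 ≤ P±` with `P⁺ + P⁻ = 1`;
`0 ≤ κ ≤ 1` with `Re⟨P_Λ(p)⟩ ≤ κ^{N^d}` for every dipole cube pattern. Let `𝒢` be a finite index
set, `bonds γ` a family of nearest-neighbour bonds `(i, j)` for each `γ ∈ 𝒢` with first ends
disjoint from second ends, and `c ↦ γ(c)` ANY map on the configurations (`c(m) = +`, `c(n) = -`)
with `γ(c) ∈ 𝒢` and `c(i) = +`, `c(j) = -` on every bond of `γ(c)`. Then
`Re⟨Pₘ⁺Pₙ⁻⟩_{β,H} ≤ Σ_{γ ∈ 𝒢} κ^{(b-1)|bonds γ|/b^{2d+1}}`.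
The choice of `𝒢`, `γ(·)` (FL: one connected separating contour per configuration) and the
counting of `γ` by length (FL Thm. 1.1) are the only remaining, purely combinatorial, inputs.
[cite: FrohlichLieb1978, eqs. (1.29)–(1.31), (1.44)–(1.45)] -/
theorem peierls_chessboard_bound_of_assignment [NeZero (N * b)] (hd : 0 < d) (hN : Even N)
    (hN1 : 1 < N) {β : ℝ} {H : Op (TorusSite d (N * b)) (n + 1)} (hH : H.IsHermitian)
    (hK : ∀ (i : Fin d) (k : ZMod N),
      IsRPExponent (N * b) i (blockPlane N b k) (hN.mul_right b) (-(β : ℂ) • H))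
    (hT : ∀ v : TorusSite d (N * b),
      H.submatrix (fun σ => σ ∘ ⇑(Equiv.addRight v)) (fun σ => σ ∘ ⇑(Equiv.addRight v)) = H)
    {Pp Pm : Matrix (Fin (n + 1)) (Fin (n + 1)) ℂ} (hPp : Pp.PosSemidef) (hPm : Pm.PosSemidef)
    (hsum : Pp + Pm = 1) (hPpr : Pp.map (starRingEnd ℂ) = Pp) (hPmr : Pm.map (starRingEnd ℂ) = Pm)
    {κ : ℝ} (hκ0 : 0 ≤ κ) (hκ1 : κ ≤ 1)
    (hsmall : ∀ (v i j : TorusSite d (N * b)),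
      (∃ k : Fin d, j = i + Pi.single k 1 ∨ i = j + Pi.single k 1) →
      blockOf N b (i - v) = blockOf N b (j - v) →
      (Matrix.gibbsState β H (productOp fun y =>
        cubePattern hN v (selectedOp Pp Pm {i} {j}) (blockOf N b (i - v))
          (mirroredOffset hN y))).re ≤ κ ^ (N ^ d))
    {m n' : TorusSite d (N * b)} (hmn : m ≠ n') {ι : Type*} (𝒢 : Finset ι)
    (bonds : ι → Finset (TorusSite d (N * b) × TorusSite d (N * b)))
    (hadj : ∀ g ∈ 𝒢, ∀ e ∈ bonds g, ∃ k : Fin d, e.2 = e.1 + Pi.single k 1 ∨ e.1 = e.2 + Pi.single k 1)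
    (hdisj : ∀ g ∈ 𝒢, Disjoint ((bonds g).image Prod.fst) ((bonds g).image Prod.snd))
    (γof : (TorusSite d (N * b) → Bool) → ι)
    (hγ : ∀ c ∈ validConfigs m n',
      γof c ∈ 𝒢 ∧ ∀ e ∈ bonds (γof c), c e.1 = true ∧ c e.2 = false) :
    (Matrix.gibbsState β H (onSite m Pp * onSite n' Pm)).re ≤
      ∑ g ∈ 𝒢, κ ^ ((b - 1) * (bonds g).card / b ^ (2 * d + 1)) := by
  classical
  have hPp1 : (1 - Pp).PosSemidef := by rw [← hsum, add_sub_cancel_left]; exact hPm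
  have hPm1 : (1 - Pm).PosSemidef := by rw [← hsum, add_sub_cancel_right]; exact hPp
  have hγ' : ∀ c ∈ validConfigs m n', γof c ∈ 𝒢 ∧
      (∀ x ∈ (bonds (γof c)).image Prod.fst, c x = true) ∧
      ∀ x ∈ (bonds (γof c)).image Prod.snd, c x = false := by
    intro c hc
    refine ⟨(hγ c hc).1, fun x hx => ?_, fun x hx => ?_⟩
    · obtain ⟨e, he, rfl⟩ := mem_image.1 hx
      exact ((hγ c hc).2 e he).1
    · obtain ⟨e, he, rfl⟩ := mem_image.1 hx
      exact ((hγ c hc).2 e he).2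
  refine (peierls_bound_of_assignment_gibbs hPp hPm hsum hmn β hH 𝒢
    (fun g => (bonds g).image Prod.fst) (fun g => (bonds g).image Prod.snd) hdisj γof hγ').trans
    (sum_le_sum fun g hg => ?_)
  rw [productOp_ite_eq_selectedOp]
  exact re_gibbsState_selectedOp_le_pow hd hN hN1 hH hK hT hPp hPm hPp1 hPm1 hPpr hPmr hκ0 hκ1 hsmall
    (bonds g) (hadj g hg) (hdisj g hg)

end Assignment

/-! ### Exact exponents: `θ^{|γ|}` with `θ = κ^{(b-1)/b^{2d+1}}` (no integer rounding) -/

section Theta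

variable {d : ℕ} {N b : ℕ} [NeZero N] [NeZero b] {n : ℕ}

/-- **The chessboard bound for a bond family with the number of selected cubes exposed**: under the
hypotheses of `re_gibbsState_selectedOp_le_pow` there is a number `c` of cubes with
`(b-1)|γ| ≤ b^{2d+1} c` and `Re⟨∏_γ Pᵢ⁺Pⱼ⁻⟩ ≤ κ^c` (FL (1.42)–(1.43) before rounding the
exponent). [cite: FrohlichLieb1978, eqs. (1.41)–(1.44)] [cite: FrohlichIsraelLiebSimon1978, Thm. 4.3] -/
theorem exists_card_cubes_re_gibbsState_selectedOp_le [NeZero (N * b)] (hd : 0 < d) (hN : Even N)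
    (hN1 : 1 < N) {β : ℝ} {H : Op (TorusSite d (N * b)) (n + 1)} (hH : H.IsHermitian)
    (hK : ∀ (i : Fin d) (k : ZMod N),
      IsRPExponent (N * b) i (blockPlane N b k) (hN.mul_right b) (-(β : ℂ) • H))
    (hT : ∀ v : TorusSite d (N * b),
      H.submatrix (fun σ => σ ∘ ⇑(Equiv.addRight v)) (fun σ => σ ∘ ⇑(Equiv.addRight v)) = H)
    {Pp Pm : Matrix (Fin (n + 1)) (Fin (n + 1)) ℂ} (hPp : Pp.PosSemidef) (hPm : Pm.PosSemidef)
    (hPp1 : (1 - Pp).PosSemidef) (hPm1 : (1 - Pm).PosSemidef)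
    (hPpr : Pp.map (starRingEnd ℂ) = Pp) (hPmr : Pm.map (starRingEnd ℂ) = Pm)
    {κ : ℝ} (hκ0 : 0 ≤ κ)
    (hsmall : ∀ (v i j : TorusSite d (N * b)),
      (∃ k : Fin d, j = i + Pi.single k 1 ∨ i = j + Pi.single k 1) →
      blockOf N b (i - v) = blockOf N b (j - v) →
      (Matrix.gibbsState β H (productOp fun y =>
        cubePattern hN v (selectedOp Pp Pm {i} {j}) (blockOf N b (i - v))
          (mirroredOffset hN y))).re ≤ κ ^ (N ^ d))
    (γ : Finset (TorusSite d (N * b) × TorusSite d (N * b)))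
    (hadj : ∀ e ∈ γ, ∃ k : Fin d, e.2 = e.1 + Pi.single k 1 ∨ e.1 = e.2 + Pi.single k 1)
    (hdisj : Disjoint (γ.image Prod.fst) (γ.image Prod.snd)) :
    ∃ c : ℕ, (b - 1) * γ.card ≤ b ^ (2 * d + 1) * c ∧
      (Matrix.gibbsState β H
        (productOp (selectedOp Pp Pm (γ.image Prod.fst) (γ.image Prod.snd)))).re ≤ κ ^ c := by
  classical
  haveI : Nonempty (TensorIndex (TorusSite d (N * b)) (n + 1)) := ⟨fun _ => 0⟩
  obtain ⟨v, D, sel, hsel, hcount⟩ := exists_shift_cube_selection γ hadj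
  refine ⟨D.card, hcount, ?_⟩
  set Sp' := D.image fun c => (sel c).1 with hSp'
  set Sm' := D.image fun c => (sel c).2 with hSm'
  have hSp : Sp' ⊆ γ.image Prod.fst := by
    intro x hx
    obtain ⟨c, hc, rfl⟩ := mem_image.1 hx
    exact mem_image.2 ⟨sel c, (hsel c hc).1, rfl⟩
  have hSm : Sm' ⊆ γ.image Prod.snd := by
    intro x hx
    obtain ⟨c, hc, rfl⟩ := mem_image.1 hx
    exact mem_image.2 ⟨sel c, (hsel c hc).1, rfl⟩
  have hpos : ∀ X : Op (TorusSite d (N * b)) (n + 1), X.PosSemidef →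
      0 ≤ (Matrix.gibbsState β H X).re :=
    fun X hX => (Complex.nonneg_iff.1 (Matrix.gibbsState_nonneg_of_posSemidef β hH hX)).1
  have hdrop : (Matrix.gibbsState β H
      (productOp (selectedOp Pp Pm (γ.image Prod.fst) (γ.image Prod.snd)))).re ≤
      (Matrix.gibbsState β H (productOp (selectedOp Pp Pm Sp' Sm'))).re :=
    re_le_re_of_productOp_le (fun x => selectedOp_posSemidef hPp hPm _ _ x)
      (fun x => selectedOp_sub_selectedOp_posSemidef hPp1 hPm1 hdisj hSp hSm x) _ hpos
  have hreal : ∀ x, (selectedOp Pp Pm Sp' Sm' x).map (starRingEnd ℂ) = selectedOp Pp Pm Sp' Sm' x := by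
    intro x
    unfold selectedOp
    split_ifs
    exacts [hPpr, hPmr, Matrix.map_one _ (map_zero _) (map_one _)]
  have hsupp : ∀ x, blockOf N b (x - v) ∉ D → selectedOp Pp Pm Sp' Sm' x = 1 := by
    intro x hx
    have h1 : x ∉ Sp' := by
      intro h
      obtain ⟨c, hc, rfl⟩ := mem_image.1 h
      exact hx (by rw [(hsel c hc).2.1]; exact hc)
    have h2 : x ∉ Sm' := by
      intro h
      obtain ⟨c, hc, rfl⟩ := mem_image.1 h
      exact hx (by rw [(hsel c hc).2.2]; exact hc)
    unfold selectedOp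
    rw [if_neg h1, if_neg h2]
  have hpow := re_gibbsState_productOp_pow_le_of_supported hd hN hN1 hH hK hT
    (selectedOp Pp Pm Sp' Sm') hreal v D hsupp
  have hfac : ∀ c ∈ D, (Matrix.gibbsState β H (productOp fun y =>
      cubePattern hN v (selectedOp Pp Pm Sp' Sm') c (mirroredOffset hN y))).re ≤ κ ^ (N ^ d) := by
    intro c hc
    have hpat := cubePattern_selectedOp_image_eq hN Pp Pm v D sel (fun c' hc' => (hsel c' hc').2) hc
    have hint : blockOf N b ((sel c).1 - v) = blockOf N b ((sel c).2 - v) := by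
      rw [(hsel c hc).2.1, (hsel c hc).2.2]
    have hs := hsmall v (sel c).1 (sel c).2 (hadj _ (hsel c hc).1) hint
    rw [(hsel c hc).2.1] at hs
    rw [hSp', hSm', hpat]
    exact hs
  have h0 : ∀ c ∈ D, 0 ≤ (Matrix.gibbsState β H (productOp fun y =>
      cubePattern hN v (selectedOp Pp Pm Sp' Sm') c (mirroredOffset hN y))).re :=
    fun c _ => re_gibbsState_blockPattern_universal_nonneg hd hN hN1 hH hK _ fun o => hreal _
  set r := (Matrix.gibbsState β H (productOp (selectedOp Pp Pm Sp' Sm'))).re with hr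
  have hn : (N ^ d : ℕ) ≠ 0 := pow_ne_zero _ (NeZero.ne N)
  have hle : |r| ^ (N ^ d) ≤ (κ ^ D.card) ^ (N ^ d) :=
    calc |r| ^ (N ^ d) ≤ ∏ c ∈ D, (Matrix.gibbsState β H (productOp fun y =>
          cubePattern hN v (selectedOp Pp Pm Sp' Sm') c (mirroredOffset hN y))).re := hpow
      _ ≤ ∏ c ∈ D, κ ^ (N ^ d) := prod_le_prod h0 hfac
      _ = (κ ^ D.card) ^ (N ^ d) := by rw [prod_const, ← pow_mul, mul_comm, pow_mul]
  have habs : |r| ≤ κ ^ D.card := le_of_pow_le_pow_left₀ hn (pow_nonneg hκ0 _) hle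
  exact hdrop.trans ((le_abs_self r).trans habs)

/-- **Exact-exponent form: `Re⟨∏_γ Pᵢ⁺Pⱼ⁻⟩ ≤ θ^{|γ|}` with `θ = κ^{(b-1)/b^{2d+1}}`** (`0 < κ ≤ 1`;
no integer rounding of the exponent, so that contours of every length carry a weight `< 1` as soon
as `κ < 1` and `b ≥ 2`). [cite: FrohlichLieb1978, eqs. (1.41)–(1.45)]
[cite: FrohlichIsraelLiebSimon1978, Thm. 4.3] -/
theorem re_gibbsState_selectedOp_le_theta_pow [NeZero (N * b)] (hd : 0 < d) (hN : Even N)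
    (hN1 : 1 < N) {β : ℝ} {H : Op (TorusSite d (N * b)) (n + 1)} (hH : H.IsHermitian)
    (hK : ∀ (i : Fin d) (k : ZMod N),
      IsRPExponent (N * b) i (blockPlane N b k) (hN.mul_right b) (-(β : ℂ) • H))
    (hT : ∀ v : TorusSite d (N * b),
      H.submatrix (fun σ => σ ∘ ⇑(Equiv.addRight v)) (fun σ => σ ∘ ⇑(Equiv.addRight v)) = H)
    {Pp Pm : Matrix (Fin (n + 1)) (Fin (n + 1)) ℂ} (hPp : Pp.PosSemidef) (hPm : Pm.PosSemidef)
    (hPp1 : (1 - Pp).PosSemidef) (hPm1 : (1 - Pm).PosSemidef)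
    (hPpr : Pp.map (starRingEnd ℂ) = Pp) (hPmr : Pm.map (starRingEnd ℂ) = Pm)
    {κ : ℝ} (hκ0 : 0 < κ) (hκ1 : κ ≤ 1)
    (hsmall : ∀ (v i j : TorusSite d (N * b)),
      (∃ k : Fin d, j = i + Pi.single k 1 ∨ i = j + Pi.single k 1) →
      blockOf N b (i - v) = blockOf N b (j - v) →
      (Matrix.gibbsState β H (productOp fun y =>
        cubePattern hN v (selectedOp Pp Pm {i} {j}) (blockOf N b (i - v))
          (mirroredOffset hN y))).re ≤ κ ^ (N ^ d))
    (γ : Finset (TorusSite d (N * b) × TorusSite d (N * b)))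
    (hadj : ∀ e ∈ γ, ∃ k : Fin d, e.2 = e.1 + Pi.single k 1 ∨ e.1 = e.2 + Pi.single k 1)
    (hdisj : Disjoint (γ.image Prod.fst) (γ.image Prod.snd)) :
    (Matrix.gibbsState β H (productOp (selectedOp Pp Pm (γ.image Prod.fst) (γ.image Prod.snd)))).re
      ≤ (κ ^ (((b - 1 : ℕ) : ℝ) / (b : ℝ) ^ (2 * d + 1))) ^ γ.card := by
  obtain ⟨c, hcount, hle⟩ := exists_card_cubes_re_gibbsState_selectedOp_le hd hN hN1 hH hK hT hPp hPm
    hPp1 hPm1 hPpr hPmr hκ0.le hsmall γ hadj hdisj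
  refine hle.trans ?_
  have hb : (0 : ℝ) < (b : ℝ) ^ (2 * d + 1) := pow_pos (Nat.cast_pos.2 (NeZero.pos b)) _
  have hexp : (((b - 1 : ℕ) : ℝ) / (b : ℝ) ^ (2 * d + 1)) * (γ.card : ℝ) ≤ (c : ℝ) := by
    rw [div_mul_eq_mul_div, div_le_iff₀ hb]
    have := hcount
    exact_mod_cast (by
      have h' : ((b - 1 : ℕ) : ℝ) * (γ.card : ℝ) ≤ (b : ℝ) ^ (2 * d + 1) * (c : ℝ) := by
        exact_mod_cast this
      linarith [mul_comm ((b : ℝ) ^ (2 * d + 1)) (c : ℝ)])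
  rw [← Real.rpow_natCast, ← Real.rpow_natCast, ← Real.rpow_mul hκ0.le]
  exact Real.rpow_le_rpow_of_exponent_ge hκ0 hκ1 hexp

/-- **FL (1.30) + (1.44) in the contour-assignment form with exact exponents:**
`Re⟨Pₘ⁺Pₙ⁻⟩_{β,H} ≤ Σ_{γ ∈ 𝒢} θ^{|bonds γ|}`, `θ = κ^{(b-1)/b^{2d+1}}`, for any compatible
assignment (hypotheses as in `peierls_chessboard_bound_of_assignment`, with `0 < κ ≤ 1`).
[cite: FrohlichLieb1978, eqs. (1.29)–(1.31), (1.44)–(1.45)] -/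
theorem peierls_chessboard_bound_of_assignment_theta [NeZero (N * b)] (hd : 0 < d) (hN : Even N)
    (hN1 : 1 < N) {β : ℝ} {H : Op (TorusSite d (N * b)) (n + 1)} (hH : H.IsHermitian)
    (hK : ∀ (i : Fin d) (k : ZMod N),
      IsRPExponent (N * b) i (blockPlane N b k) (hN.mul_right b) (-(β : ℂ) • H))
    (hT : ∀ v : TorusSite d (N * b),
      H.submatrix (fun σ => σ ∘ ⇑(Equiv.addRight v)) (fun σ => σ ∘ ⇑(Equiv.addRight v)) = H)
    {Pp Pm : Matrix (Fin (n + 1)) (Fin (n + 1)) ℂ} (hPp : Pp.PosSemidef) (hPm : Pm.PosSemidef)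
    (hsum : Pp + Pm = 1) (hPpr : Pp.map (starRingEnd ℂ) = Pp) (hPmr : Pm.map (starRingEnd ℂ) = Pm)
    {κ : ℝ} (hκ0 : 0 < κ) (hκ1 : κ ≤ 1)
    (hsmall : ∀ (v i j : TorusSite d (N * b)),
      (∃ k : Fin d, j = i + Pi.single k 1 ∨ i = j + Pi.single k 1) →
      blockOf N b (i - v) = blockOf N b (j - v) →
      (Matrix.gibbsState β H (productOp fun y =>
        cubePattern hN v (selectedOp Pp Pm {i} {j}) (blockOf N b (i - v))
          (mirroredOffset hN y))).re ≤ κ ^ (N ^ d))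
    {m n' : TorusSite d (N * b)} (hmn : m ≠ n') {ι : Type*} (𝒢 : Finset ι)
    (bonds : ι → Finset (TorusSite d (N * b) × TorusSite d (N * b)))
    (hadj : ∀ g ∈ 𝒢, ∀ e ∈ bonds g, ∃ k : Fin d, e.2 = e.1 + Pi.single k 1 ∨ e.1 = e.2 + Pi.single k 1)
    (hdisj : ∀ g ∈ 𝒢, Disjoint ((bonds g).image Prod.fst) ((bonds g).image Prod.snd))
    (γof : (TorusSite d (N * b) → Bool) → ι)
    (hγ : ∀ c ∈ validConfigs m n',
      γof c ∈ 𝒢 ∧ ∀ e ∈ bonds (γof c), c e.1 = true ∧ c e.2 = false) :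
    (Matrix.gibbsState β H (onSite m Pp * onSite n' Pm)).re ≤
      ∑ g ∈ 𝒢, (κ ^ (((b - 1 : ℕ) : ℝ) / (b : ℝ) ^ (2 * d + 1))) ^ (bonds g).card := by
  classical
  have hPp1 : (1 - Pp).PosSemidef := by rw [← hsum, add_sub_cancel_left]; exact hPm
  have hPm1 : (1 - Pm).PosSemidef := by rw [← hsum, add_sub_cancel_right]; exact hPp
  have hγ' : ∀ c ∈ validConfigs m n', γof c ∈ 𝒢 ∧
      (∀ x ∈ (bonds (γof c)).image Prod.fst, c x = true) ∧
      ∀ x ∈ (bonds (γof c)).image Prod.snd, c x = false := by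
    intro c hc
    refine ⟨(hγ c hc).1, fun x hx => ?_, fun x hx => ?_⟩
    · obtain ⟨e, he, rfl⟩ := mem_image.1 hx
      exact ((hγ c hc).2 e he).1
    · obtain ⟨e, he, rfl⟩ := mem_image.1 hx
      exact ((hγ c hc).2 e he).2
  refine (peierls_bound_of_assignment_gibbs hPp hPm hsum hmn β hH 𝒢
    (fun g => (bonds g).image Prod.fst) (fun g => (bonds g).image Prod.snd) hdisj γof hγ').trans
    (sum_le_sum fun g hg => ?_)
  rw [productOp_ite_eq_selectedOp]
  exact re_gibbsState_selectedOp_le_theta_pow hd hN hN1 hH hK hT hPp hPm hPp1 hPm1 hPpr hPmr hκ0 hκ1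
    hsmall (bonds g) (hadj g hg) (hdisj g hg)

end Theta

/-! ### The antiferromagnet with direction-dependent couplings (rotated frame) -/

section Model

variable {d : ℕ} {N b : ℕ} [NeZero N] [NeZero b] (n : ℕ)

/-- **The assignment-form Peierls–chessboard bound for the rotated antiferromagnet `H♭_K` with
direction-dependent couplings `K ≥ 0`** on `(ℤ/Nbℤ)^d` (`N` even, `N > 1`, every spin, every
`β ≥ 0`): Hermiticity, reflection positivity across all pairs of planes
(`heisWeightedReal_isRPExponent`) and translation invariance hold, so for real `0 ≤ P±`,
`P⁺ + P⁻ = 1`, a dipole smallness bound `Re⟨P_Λ(p)⟩ ≤ κ^{N^d}` (`0 ≤ κ ≤ 1`) and any compatible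
assignment `c ↦ γ(c) ∈ 𝒢` of nearest-neighbour bond families:
`Re⟨Pₘ⁺Pₙ⁻⟩_{β,H♭_K} ≤ Σ_{γ ∈ 𝒢} κ^{(b-1)|γ|/b^{2d+1}}`.
[cite: FrohlichLieb1978, eqs. (1.30), (1.44)–(1.45), §I.A (3)] -/
theorem heisAnisoReal_peierls_chessboard_bound_of_assignment [NeZero (N * b)] (hd : 0 < d)
    (hN : Even N) (hN1 : 1 < N) {K : Fin d → ℝ} (hK : ∀ i, 0 ≤ K i) {β : ℝ} (hβ : 0 ≤ β)
    {Pp Pm : Matrix (Fin (n + 1)) (Fin (n + 1)) ℂ} (hPp : Pp.PosSemidef) (hPm : Pm.PosSemidef)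
    (hsum : Pp + Pm = 1) (hPpr : Pp.map (starRingEnd ℂ) = Pp) (hPmr : Pm.map (starRingEnd ℂ) = Pm)
    {κ : ℝ} (hκ0 : 0 ≤ κ) (hκ1 : κ ≤ 1)
    (hsmall : ∀ (v i j : TorusSite d (N * b)),
      (∃ k : Fin d, j = i + Pi.single k 1 ∨ i = j + Pi.single k 1) →
      blockOf N b (i - v) = blockOf N b (j - v) →
      (Matrix.gibbsState β (heisWeightedRealFieldHamiltonian (N * b) n (dirCoupling (N * b) K) 0)
        (productOp fun y => cubePattern hN v (selectedOp Pp Pm {i} {j}) (blockOf N b (i - v))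
          (mirroredOffset hN y))).re ≤ κ ^ (N ^ d))
    {m n' : TorusSite d (N * b)} (hmn : m ≠ n') {ι : Type*} (𝒢 : Finset ι)
    (bonds : ι → Finset (TorusSite d (N * b) × TorusSite d (N * b)))
    (hadj : ∀ g ∈ 𝒢, ∀ e ∈ bonds g, ∃ k : Fin d, e.2 = e.1 + Pi.single k 1 ∨ e.1 = e.2 + Pi.single k 1)
    (hdisj : ∀ g ∈ 𝒢, Disjoint ((bonds g).image Prod.fst) ((bonds g).image Prod.snd))
    (γof : (TorusSite d (N * b) → Bool) → ι)
    (hγ : ∀ c ∈ validConfigs m n',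
      γof c ∈ 𝒢 ∧ ∀ e ∈ bonds (γof c), c e.1 = true ∧ c e.2 = false) :
    (Matrix.gibbsState β (heisWeightedRealFieldHamiltonian (N * b) n (dirCoupling (N * b) K) 0)
        (onSite m Pp * onSite n' Pm)).re ≤
      ∑ g ∈ 𝒢, κ ^ ((b - 1) * (bonds g).card / b ^ (2 * d + 1)) :=
  peierls_chessboard_bound_of_assignment hd hN hN1
    (heisWeightedRealFieldHamiltonian_isHermitian (N * b) n _ 0)
    (fun i k => heisWeightedReal_isRPExponent (N * b) n (hN.mul_right b) (dirCoupling_nonneg _ hK)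
      (fun j a e => dirCoupling_map_reflectBetweenSites (N * b) j a K e) hβ i (blockPlane N b k))
    (heisWeightedRealFieldHamiltonian_submatrix_comp_addRight (N * b) n
      (fun u e => dirCoupling_map_addRight (N * b) K u e))
    hPp hPm hsum hPpr hPmr hκ0 hκ1 hsmall hmn 𝒢 bonds hadj hdisj γof hγ

end Model

end Literature.MathematicalPhysics.QuantumLattice

end
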